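import Literature.MathematicalPhysics.QuantumFieldTheory.Balaban1983to89.B1Eq324BenfattoSect5FreeStep
import Literature.MathematicalPhysics.QuantumFieldTheory.Balaban1983to89.B1Eq324BenfattoSect5Iteration
import Literature.MathematicalPhysics.QuantumFieldTheory.Balaban1983to89.B1Eq324BenfattoCondKernelGeneric
import HarnessLib

/-!
# `Balaban1983to89.B1Eq324BenfattoKernelSect5FreeStep` — [BenfattoEtAl1978] §5 pp. 158–159, (5.31)–(5.35) and p. 159 «a new pavement
# displaced by b²/2»: THE FREE-CUMULANT SIDE OF ONE PAVEMENT STEP UNDER A GENERAL REFERENCE MEASURE — the two identities of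
# `…Sect5FreeStep` hold for EVERY finite measure under which the tuple-class slots have absolute moments (no Gaussianity, no
# translation invariance), the moment row is discharged for the centred Gaussian field of ANY positive-semidefinite kernel, and the
# frame change of the free truncated expectations is kernel COVARIANCE (`K ↦ K(·+τ, ·+τ)`) instead of invariance — PROVED

statement-level skeleton of published theorems with citation tags; proofs where landed; nothing here is a claim about the
Yang–Mills mass gap

WHY THIS MODULE (cell `pub-ymgap`, seat `dag-n08-b` gen 11; node N08 [Balaban1985UV3]; the [BenfattoEtAl1978] source chain behind the
(α)-row `h324c`).  The tree's Basic Lemma (`…Sect5BasicLemma.basicLemmaPrinted_holds`) is proved for [2]'s concrete free field `P̂₀ = P0 d α β`.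
The cluster-side port map of the sibling seat (`HOME/pub-ymgap-dag-n08-c/N08-PORT-MAP-CLUSTER-SIDE.md` §3, §4 (a)) leaves ONE question to the
free side, whose identification layer (`…Sect5FreeStep`, `…Sect5FreeCumulants`) is this seat's: under which REFERENCE Gaussian `𝓔̂^T_0` do the
extracted per-box exponents telescope when the covariance is NOT translation invariant (for [Balaban1985UV3] the step covariances are covariant
under the block lattice only)?  This file records the answer in the kernel: (§1) the two identities of `…Sect5FreeStep` — «`E(□)` is a difference
of free cumulants» ((5.31)/(5.32)) and «summed over the boxes the differences telescope against the free cumulants of the current and of the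
handed-on Hamiltonian minus CROSS minus `Σ_□W₂₉(□)`» ((5.35)) — are MEASURE-GENERIC: they hold verbatim for every finite measure `μ` on the
configurations under which every tuple-class sum of (5.5)-terms is a.e.-strongly measurable with all absolute moments (ONE displayed row; the
proofs are those of `…Sect5FreeStep` with `P̂₀ ↦ μ`, resting on the measure-generic `…Sect5FreeCumulants`); (§2) that row is DISCHARGED for the
centred Gaussian field `μ_K = gaussianFieldOfKernel K` of any positive-semidefinite kernel `K` on `ℤ^d` with a diagonal bound `K(y,y) ≤ c` on
the support `J` of the datum (the port map's row R1) — by `…Sect5SlotMoments.tupleSum_eq_poly` and r14's `…GaussianMomentLeaf.integrable_abs_poly_pow`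
on the sub-Gaussian coordinates `…Sect5SlotMoments.hasSubgaussianMGF_eval_gaussianFieldOfKernel`; and the ONLY place where the free side of the
chain uses a symmetry of the measure — the frame change `…Sect5PavementChain.truncatedExp_hamiltonian_frame` (translation INVARIANCE of `P̂₀`) —
becomes COVARIANCE for a general kernel: `Ê^T_{μ_K}(H^{A(·−τ)}_{J+τ}; k) = Ê^T_{μ_{K(·+τ,·+τ)}}(H^A_J; k)` (`…CondKernelGeneric.integral_gaussianFieldOfKernel_comp_add_right`,
seat dag-n08-c); (§3) §1 instantiated at `μ_K`.  CONSEQUENCE FOR THE PORT MAP (§4 (a), free side's answer, recorded in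
`HOME/pub-ymgap-dag-n08-b/N08-CLASS-TOOLKIT.md` §6): the reference Gaussian of a class edition is the UNCONDITIONED class field itself,
`K_ref = K_Λ` (the zero-extended inverse of the precision), read in frame `j` as `K_Λ(·+σ_j, ·+σ_j)` — the class is shift-closed, so nothing
is asked of `K_ref` beyond membership; the identification survives for non-invariant `K_ref` at the sole price of indexing the reference kernel
by the frame.

THE PRINTED TEXT (pp. 158–159; quoted in full in the headers of `…Sect5PerBox` / `…Sect5FreeCumulants` / `…KernelCondTranslation`): (5.31)–(5.35)
and p. 159 *"we can proceed as before choosing a new pavement Q′_b displaced by b²/2 with respect to Q_b"*.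

DICTIONARY.  `Ê^T_μ(S; k)` ↦ `B1Eq324BenfattoLemma.truncatedExp μ S k` (moment-defined, any measure); the pieces `Ψ′₁ = psi1p`, `Ψ″₁ = psi1pp`,
`Ψ₁ = psi1`, `Ψ₂ = psi2` of box `□_m` (`…Sect5Eq524`), `H_R = hamiltonian … R` (`…Sect5Boxes`); the telescope palette `Option (↥B × Bool)` of
`…Sect5FreeStep` (`none ↦ H_{Γ₁}`, `(m,false) ↦ Ψ′₁(m)+Ψ₂(m)`, `(m,true) ↦ Ψ″₁(m)`); `μ_K = gaussianFieldOfKernel K`; the translated datum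
`shiftCoef a (−τ)` on `J + τ` (`…Sect5Iteration`, `…Sect5PavementChain` §1).

WHAT IS PROVED (theorems only; no definition, no named fact, no `sorry`; axioms standard).
* §1 (any finite measure `μ`, moment row `hmom`) ★ `perBoxE_eq_sum_truncatedExp_sub_of_moments`, ★★ `sum_truncatedExp_sub_eq_telescope_of_moments`.
* §2 (any positive-semidefinite `K`, `K(y,y) ≤ c` on `J`) ★ `tupleSum_gaussianFieldOfKernel_moments` (the row of §1 discharged);
  (any positive-semidefinite `K`) ★ `truncatedExp_hamiltonian_frame_kernel`, `cumulantSum_hamiltonian_frame_kernel` (frame COVARIANCE).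
* §3 `perBoxE_eq_sum_truncatedExp_sub_kernel`, ★ `sum_truncatedExp_sub_eq_telescope_kernel` (§1 at `μ_K`).
At `μ = P0 d α β` (= `μ_{freeCov}`) §1/§3 are `…Sect5FreeStep.perBoxE_eq_sum_truncatedExp_sub` / `sum_truncatedExp_sub_eq_telescope` and §2's
frame theorem is `…Sect5PavementChain.truncatedExp_hamiltonian_frame` after `…Translation.freeCov_add_right`; those are not restated.

HONEST SCOPE / NOT HERE.  Identities and a moment row only.  The BOUNDS of the free side (`…Sect5FreeStepCross*`, `…Sect5FreePerturb`,
`…Sect5Psi3Cumulants`, `…Sect5Eq534Cumulants`) consume Appendix-D cluster bounds under the reference field and port only after kernel editions of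
`…Sect5TupleClusters{,Decay,Anchored}` (port-map rows 3–5, not this seat's); the port is NOT commissioned and nothing is chained; no generalised
Basic Lemma is stated; `BasicLemmaPrinted` is already a theorem and is not used; count-neutral for N08; nothing of [Balaban1985UV3] (41)/(47)/(5)
is asserted; nothing about d = 4, the continuum, OS axioms, a mass gap or the Clay problem.
-/

open MeasureTheory ProbabilityTheory Finset
open scoped BigOperators Nat NNReal

namespace Literature.MathematicalPhysics.QuantumFieldTheory.Balaban1983to89.B1Eq324BenfattoKernelSect5FreeStep

open _root_.MeasureTheory _root_.ProbabilityTheory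
open Literature.Probability.LatticeModels (setPartitions ursellOf cumulantOf)
open Literature.MathematicalPhysics.QuantumFieldTheory
open Literature.MathematicalPhysics.QuantumFieldTheory.Balaban1983to89.B1Eq324GaussianMomentLeaf
  (poly integrable_abs_poly_pow aestronglyMeasurable_poly)
open Literature.MathematicalPhysics.QuantumFieldTheory.Balaban1983to89.B1Eq324BenfattoLemma
open Literature.MathematicalPhysics.QuantumFieldTheory.Balaban1983to89.B1Eq324BenfattoSect5Boxes
open Literature.MathematicalPhysics.QuantumFieldTheory.Balaban1983to89.B1Eq324BenfattoSect5Eq511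
open Literature.MathematicalPhysics.QuantumFieldTheory.Balaban1983to89.B1Eq324BenfattoSect5Eq515 (measurable_hamiltonian)
open Literature.MathematicalPhysics.QuantumFieldTheory.Balaban1983to89.B1Eq324BenfattoSect5Eq524
open Literature.MathematicalPhysics.QuantumFieldTheory.Balaban1983to89.B1Eq324BenfattoSect5Iteration (shiftCoef hamiltonian_translate)
open Literature.MathematicalPhysics.QuantumFieldTheory.Balaban1983to89.B1Eq324BenfattoSect5PerBoxOnData
  (psi1p_eq_tupleSum psi1pp_eq_tupleSum psi2_eq_tupleSum)
open Literature.MathematicalPhysics.QuantumFieldTheory.Balaban1983to89.B1Eq324BenfattoSect5FreeCumulants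
  (cumulantOf_two_sub_eq_of_moments cumulantOf_three_eq_of_moments cumulantOf_telescope_eq_sum_local_add_cross)
open Literature.MathematicalPhysics.QuantumFieldTheory.Balaban1983to89.B1Eq324BenfattoSect5SlotMoments
  (hasSubgaussianMGF_eval_gaussianFieldOfKernel legPairs_injective card_legs tupleSum_eq_poly)
open Literature.MathematicalPhysics.QuantumFieldTheory.Balaban1983to89.B1Eq324BenfattoCondKernelGeneric
  (isPosSemidefKernel_reindex integral_gaussianFieldOfKernel_comp_add_right)

variable {d : ℕ}

/-! ## §1  The two free-side identities for ANY finite measure with the moment row -/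

section MeasureGeneric

variable {s D : ℕ} {κ : ℝ} {a : Coef d} {J : Finset (B1Eq324BenfattoLemma.Site d)} {L w v : ℕ}
  {μ : Measure (B1Eq324BenfattoLemma.Site d → ℝ)} [IsFiniteMeasure μ]

/-- All absolute moments of a sum of two variables with all absolute moments (`|f+g|^q ≤ 2^q(|f|^q + |g|^q)`). [folklore] -/
private theorem integrable_abs_add_pow {Ω : Type*} {mΩ : MeasurableSpace Ω} {ν : Measure Ω} {f g : Ω → ℝ}
    (hfm : AEStronglyMeasurable f ν) (hgm : AEStronglyMeasurable g ν)
    (hf : ∀ q : ℕ, Integrable (fun ω => |f ω| ^ q) ν) (hg : ∀ q : ℕ, Integrable (fun ω => |g ω| ^ q) ν) (q : ℕ) :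
    Integrable (fun ω => |f ω + g ω| ^ q) ν := by
  refine Integrable.mono' (((hf q).add (hg q)).const_mul (2 ^ q))
    ((continuous_abs.comp_aestronglyMeasurable (hfm.add hgm)).pow q |>.congr (ae_of_all _ fun ω => by simp))
    (ae_of_all _ fun ω => ?_)
  rw [Real.norm_eq_abs, abs_pow, abs_abs]
  have h1 : |f ω + g ω| ≤ 2 * max |f ω| |g ω| :=
    (abs_add_le _ _).trans (by linarith [le_max_left |f ω| |g ω|, le_max_right |f ω| |g ω|])
  have h2 : |f ω + g ω| ^ q ≤ (2 * max |f ω| |g ω|) ^ q := pow_le_pow_left₀ (abs_nonneg _) h1 q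
  have h3 : (max |f ω| |g ω|) ^ q ≤ |f ω| ^ q + |g ω| ^ q := by
    rcases le_total |f ω| |g ω| with h | h
    · rw [max_eq_right h]; linarith [pow_nonneg (abs_nonneg (f ω)) q]
    · rw [max_eq_left h]; linarith [pow_nonneg (abs_nonneg (g ω)) q]
  calc |f ω + g ω| ^ q ≤ (2 * max |f ω| |g ω|) ^ q := h2
    _ = 2 ^ q * (max |f ω| |g ω|) ^ q := by rw [mul_pow]
    _ ≤ 2 ^ q * (|f ω| ^ q + |g ω| ^ q) := mul_le_mul_of_nonneg_left h3 (pow_nonneg (by norm_num) q)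

/-- **THE EXTRACTED PER-BOX EXPONENT IS A DIFFERENCE OF FREE CUMULANTS, FOR ANY REFERENCE MEASURE** ((5.31)/(5.32)): under a finite
measure `μ` for which every tuple-class sum of (5.5)-terms has all absolute moments (row `hmom`), the sum over the colourings of `k ≤ t`
slots using `Ψ″₁` and avoiding `Ψ₂` of the `μ`-Ursell functions of the tuple-class slots of box `□_m` equals
`Σ_{k<t} [Ê^T_μ(Ψ₁(□); k+1) − Ê^T_μ(Ψ′₁(□); k+1)]/(k+1)!` — the proof of `…Sect5FreeStep.perBoxE_eq_sum_truncatedExp_sub` with `P̂₀ ↦ μ`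
(`…FreeCumulants.cumulantOf_two_sub_eq_of_moments` is measure-generic). [cite: BenfattoEtAl1978, (5.31)–(5.32) p.158] -/
theorem perBoxE_eq_sum_truncatedExp_sub_of_moments (hJ : CoefSupportedIn a J) {m : B1Eq324BenfattoLemma.Site d}
    (hmom : ∀ T : (p : ℕ) → Finset (Fin p → J),
      AEStronglyMeasurable (fun z : B1Eq324BenfattoLemma.Site d → ℝ =>
          ∑ p ∈ Finset.Icc 1 s, ∑ Δ ∈ T p, ∑ n ∈ admissible p D, term κ a z p Δ n) μ ∧
        ∀ q : ℕ, Integrable (fun z : B1Eq324BenfattoLemma.Site d → ℝ =>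
          |∑ p ∈ Finset.Icc 1 s, ∑ Δ ∈ T p, ∑ n ∈ admissible p D, term κ a z p Δ n| ^ q) μ)
    (T : Fin 3 → (p : ℕ) → Finset (Fin p → J))
    (hT0 : ∀ p, T 0 p = tuplesIn J p (frame4 L w v m) ∪ crossT J p (frame4 L w v m) (frame3 L w v m))
    (hT1 : ∀ p, T 1 p = (tuplesIn J p (core L w m) \ tuplesIn J p (frame4 L w v m)) ∪
      (crossT J p (core L w m) (frame3 L w v m) \ crossT J p (frame4 L w v m) (frame3 L w v m)))
    (t : ℕ) :
    ∑ k ∈ Finset.range t,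
        (∑ f ∈ univ.filter (fun f : Fin (k + 1) → Fin 3 => (∃ j, f j = 1) ∧ ∀ j, f j ≠ 2),
          ursellOf (fun P : Finset (Fin (k + 1)) => ∫ z, ∏ j ∈ P,
            (∑ p ∈ Finset.Icc 1 s, ∑ Δ ∈ T (f j) p, ∑ n ∈ admissible p D, term κ a z p Δ n) ∂μ) univ) / (k + 1)! =
      ∑ k ∈ Finset.range t,
        (truncatedExp μ (psi1 s D κ a L w v m) (k + 1) - truncatedExp μ (psi1p s D κ a L w v m) (k + 1)) / (k + 1)! := by
  refine Finset.sum_congr rfl fun k _ => ?_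
  congr 1
  have hm := fun c => hmom (T c)
  have h := cumulantOf_two_sub_eq_of_moments (μ := μ)
    (Y := fun c z => ∑ p ∈ Finset.Icc 1 s, ∑ Δ ∈ T c p, ∑ n ∈ admissible p D, term κ a z p Δ n)
    (fun c => (hm c).1) k (fun c p _ => (hm c).2 p)
  beta_reduce at h
  rw [← h]
  have h0 : ∀ z, (∑ p ∈ Finset.Icc 1 s, ∑ Δ ∈ T 0 p, ∑ n ∈ admissible p D, term κ a z p Δ n) = psi1p s D κ a L w v m z :=
    fun z => by simp only [hT0]; exact (psi1p_eq_tupleSum hJ z).symm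
  have h1 : ∀ z, (∑ p ∈ Finset.Icc 1 s, ∑ Δ ∈ T 1 p, ∑ n ∈ admissible p D, term κ a z p Δ n) = psi1pp s D κ a L w v m z :=
    fun z => by simp only [hT1]; exact (psi1pp_eq_tupleSum hJ z).symm
  have e1 : (fun r => ∫ z, ((∑ p ∈ Finset.Icc 1 s, ∑ Δ ∈ T 0 p, ∑ n ∈ admissible p D, term κ a z p Δ n) +
      (∑ p ∈ Finset.Icc 1 s, ∑ Δ ∈ T 1 p, ∑ n ∈ admissible p D, term κ a z p Δ n)) ^ r ∂μ) =
      fun r => ∫ z, (psi1 s D κ a L w v m z) ^ r ∂μ := by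
    funext r
    refine integral_congr_ae (ae_of_all _ fun z => ?_)
    dsimp only
    rw [h0 z, h1 z, psi1pp, add_sub_cancel]
  have e0 : (fun r => ∫ z, (∑ p ∈ Finset.Icc 1 s, ∑ Δ ∈ T 0 p, ∑ n ∈ admissible p D, term κ a z p Δ n) ^ r ∂μ) =
      fun r => ∫ z, (psi1p s D κ a L w v m z) ^ r ∂μ := by
    funext r
    refine integral_congr_ae (ae_of_all _ fun z => ?_)
    dsimp only
    rw [h0 z]
  rw [e1, e0, truncatedExp, truncatedExp]

omit [IsFiniteMeasure μ] in
/-- `Ψ′₁`, `Ψ″₁`, `Ψ₂` and every region Hamiltonian inherit the moment row (each is ONE tuple-class sum: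
`…PerBoxOnData.psi1p_eq_tupleSum` / `psi1pp_eq_tupleSum` / `psi2_eq_tupleSum`, `…Eq511.hamiltonian_eq_sum_tuplesIn`).
[cite: BenfattoEtAl1978, (5.23)–(5.24) p.157, Appendix C 2) p.164] -/
theorem psi_moments_of_moments (hJ : CoefSupportedIn a J)
    (hmom : ∀ T : (p : ℕ) → Finset (Fin p → J),
      AEStronglyMeasurable (fun z : B1Eq324BenfattoLemma.Site d → ℝ =>
          ∑ p ∈ Finset.Icc 1 s, ∑ Δ ∈ T p, ∑ n ∈ admissible p D, term κ a z p Δ n) μ ∧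
        ∀ q : ℕ, Integrable (fun z : B1Eq324BenfattoLemma.Site d → ℝ =>
          |∑ p ∈ Finset.Icc 1 s, ∑ Δ ∈ T p, ∑ n ∈ admissible p D, term κ a z p Δ n| ^ q) μ)
    (m : B1Eq324BenfattoLemma.Site d) (R : Finset (B1Eq324BenfattoLemma.Site d)) :
    (AEStronglyMeasurable (fun z => psi1p s D κ a L w v m z) μ ∧
        ∀ q : ℕ, Integrable (fun z => |psi1p s D κ a L w v m z| ^ q) μ) ∧
      (AEStronglyMeasurable (fun z => psi1pp s D κ a L w v m z) μ ∧
        ∀ q : ℕ, Integrable (fun z => |psi1pp s D κ a L w v m z| ^ q) μ) ∧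
      (AEStronglyMeasurable (fun z => psi2 s D κ a L w m z) μ ∧
        ∀ q : ℕ, Integrable (fun z => |psi2 s D κ a L w m z| ^ q) μ) ∧
      (AEStronglyMeasurable (fun z => hamiltonian s D κ a R z) μ ∧
        ∀ q : ℕ, Integrable (fun z => |hamiltonian s D κ a R z| ^ q) μ) := by
  have e0 : ∀ z, psi1p s D κ a L w v m z = ∑ p ∈ Finset.Icc 1 s,
      ∑ Δ ∈ tuplesIn J p (frame4 L w v m) ∪ crossT J p (frame4 L w v m) (frame3 L w v m),
        ∑ n ∈ admissible p D, term κ a z p Δ n := fun z => psi1p_eq_tupleSum hJ z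
  have e1 : ∀ z, psi1pp s D κ a L w v m z = ∑ p ∈ Finset.Icc 1 s,
      ∑ Δ ∈ (tuplesIn J p (core L w m) \ tuplesIn J p (frame4 L w v m)) ∪
          (crossT J p (core L w m) (frame3 L w v m) \ crossT J p (frame4 L w v m) (frame3 L w v m)),
        ∑ n ∈ admissible p D, term κ a z p Δ n := fun z => psi1pp_eq_tupleSum hJ z
  have e2 : ∀ z, psi2 s D κ a L w m z = ∑ p ∈ Finset.Icc 1 s,
      ∑ Δ ∈ crossT J p (frame1 L w m) (frame2 L w m) ∪ tuplesIn J p (frame2 L w m),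
        ∑ n ∈ admissible p D, term κ a z p Δ n := fun z => psi2_eq_tupleSum hJ z
  have eR : ∀ z, hamiltonian s D κ a R z = ∑ p ∈ Finset.Icc 1 s,
      ∑ Δ ∈ tuplesIn J p R, ∑ n ∈ admissible p D, term κ a z p Δ n := fun z => hamiltonian_eq_sum_tuplesIn hJ R z
  refine ⟨?_, ?_, ?_, ?_⟩
  · simp only [e0]; exact hmom _
  · simp only [e1]; exact hmom _
  · simp only [e2]; exact hmom _
  · simp only [eR]; exact hmom _

/-- **THE EXTRACTED EXPONENTS OF ALL BOXES TELESCOPE AGAINST THE FREE CUMULANTS OF THE CURRENT AND THE NEXT HAMILTONIAN, FOR ANY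
REFERENCE MEASURE** ((5.35) and «Collecting all the errors made in this process», p. 159): under a finite measure `μ` with the moment row
`hmom`, with the boxes `□_m, m ∈ B`, the pieces `Ψ′₁(m), Ψ″₁(m), Ψ₂(m)` and the corridor Hamiltonian `H_{Γ₁}`, at every order `k+1`,
`Σ_{m∈B} [T_μ(Ψ₁(m)) − T_μ(Ψ′₁(m))] = T_μ(H_{Γ₁} + Σ_m(Ψ₁+Ψ₂)(m)) − T_μ(H_{Γ₁} + Σ_m(Ψ′₁+Ψ₂)(m)) − CROSS_μ − Σ_{m∈B} W₂₉,μ(m)`,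
`T_μ = truncatedExp μ`, CROSS and `W₂₉` as in `…Sect5FreeStep.sum_truncatedExp_sub_eq_telescope` with `P̂₀ ↦ μ` — the same proof
(`…FreeCumulants.cumulantOf_telescope_eq_sum_local_add_cross` / `cumulantOf_three_eq_of_moments` are measure-generic).  No Gaussianity and
no symmetry of `μ` is used. [cite: BenfattoEtAl1978, (5.31)–(5.35) pp.158–159] -/
theorem sum_truncatedExp_sub_eq_telescope_of_moments {B : Finset (B1Eq324BenfattoLemma.Site d)} (hJ : CoefSupportedIn a J)
    (hmom : ∀ T : (p : ℕ) → Finset (Fin p → J),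
      AEStronglyMeasurable (fun z : B1Eq324BenfattoLemma.Site d → ℝ =>
          ∑ p ∈ Finset.Icc 1 s, ∑ Δ ∈ T p, ∑ n ∈ admissible p D, term κ a z p Δ n) μ ∧
        ∀ q : ℕ, Integrable (fun z : B1Eq324BenfattoLemma.Site d → ℝ =>
          |∑ p ∈ Finset.Icc 1 s, ∑ Δ ∈ T p, ∑ n ∈ admissible p D, term κ a z p Δ n| ^ q) μ)
    (Y : Option (↥B × Bool) → (B1Eq324BenfattoLemma.Site d → ℝ) → ℝ)
    (hYn : Y none = fun z => hamiltonian s D κ a (corridors L w B) z)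
    (hYf : ∀ m : ↥B, Y (some (m, false)) = fun z => psi1p s D κ a L w v m z + psi2 s D κ a L w m z)
    (hYt : ∀ m : ↥B, Y (some (m, true)) = fun z => psi1pp s D κ a L w v m z) (k : ℕ) :
    ∑ m ∈ B, (truncatedExp μ (psi1 s D κ a L w v m) (k + 1) - truncatedExp μ (psi1p s D κ a L w v m) (k + 1)) =
      truncatedExp μ
          (fun z => hamiltonian s D κ a (corridors L w B) z + ∑ m ∈ B, (psi1 s D κ a L w v m z + psi2 s D κ a L w m z)) (k + 1)
        - truncatedExp μ
          (fun z => hamiltonian s D κ a (corridors L w B) z + ∑ m ∈ B, (psi1p s D κ a L w v m z + psi2 s D κ a L w m z)) (k + 1)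
        - ∑ f ∈ univ.filter (fun f : Fin (k + 1) → Option (↥B × Bool) =>
            (∃ j m, f j = some (m, true)) ∧ ¬∃ m, ∀ j, f j = some (m, false) ∨ f j = some (m, true)),
            ursellOf (fun P : Finset (Fin (k + 1)) => ∫ z, ∏ j ∈ P, Y (f j) z ∂μ) univ
        - ∑ m ∈ B, ∑ f ∈ univ.filter (fun f : Fin (k + 1) → Fin 3 => (∃ j, f j = 1) ∧ ∃ j, f j = 2),
            ursellOf (fun P : Finset (Fin (k + 1)) => ∫ z, ∏ j ∈ P,
              (![fun z => psi1p s D κ a L w v m z, fun z => psi1pp s D κ a L w v m z, fun z => psi2 s D κ a L w m z] (f j)) z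
                ∂μ) univ := by
  have hmo := fun m : B1Eq324BenfattoLemma.Site d =>
    psi_moments_of_moments (μ := μ) (s := s) (D := D) (κ := κ) (L := L) (w := w) (v := v) hJ hmom m (corridors L w B)
  -- moments of the palette
  have hYm : ∀ c, AEStronglyMeasurable (Y c) μ := by
    rintro (_ | ⟨m, b⟩)
    · rw [hYn]; exact (hmo 0).2.2.2.1
    · cases b
      · rw [hYf]; exact (hmo m).1.1.add (hmo m).2.2.1.1
      · rw [hYt]; exact (hmo m).2.1.1
  have hYint : ∀ c (p : ℕ), p ≤ k + 1 → Integrable (fun z => |Y c z| ^ p) μ := by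
    rintro (_ | ⟨m, b⟩) p _
    · rw [hYn]; exact (hmo 0).2.2.2.2 p
    · cases b
      · rw [hYf]
        exact integrable_abs_add_pow (hmo m).1.1 (hmo m).2.2.1.1 (hmo m).1.2 (hmo m).2.2.1.2 p
      · rw [hYt]; exact (hmo m).2.1.2 p
  have htel := cumulantOf_telescope_eq_sum_local_add_cross (μ := μ) hYm k hYint
  -- the three sums of the palette
  have hsumAll : (fun r => ∫ z, (∑ c, Y c z) ^ r ∂μ) = fun r => ∫ z,
      (hamiltonian s D κ a (corridors L w B) z + ∑ m ∈ B, (psi1 s D κ a L w v m z + psi2 s D κ a L w m z)) ^ r ∂μ := by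
    funext r
    refine integral_congr_ae (ae_of_all _ fun z => ?_)
    dsimp only
    congr 1
    rw [Fintype.sum_option, Fintype.sum_prod_type, ← Finset.sum_coe_sort B]
    simp only [Fintype.sum_bool, hYn, hYf, hYt, psi1pp]
    refine congrArg _ (Finset.sum_congr rfl fun m _ => ?_)
    ring
  have hsumRest : (fun r => ∫ z, (Y none z + ∑ m, Y (some (m, false)) z) ^ r ∂μ) = fun r => ∫ z,
      (hamiltonian s D κ a (corridors L w B) z + ∑ m ∈ B, (psi1p s D κ a L w v m z + psi2 s D κ a L w m z)) ^ r ∂μ := by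
    funext r
    refine integral_congr_ae (ae_of_all _ fun z => ?_)
    dsimp only
    congr 1
    rw [← Finset.sum_coe_sort B]
    simp only [hYn, hYf]
  have hbox : ∀ m : ↥B,
      cumulantOf (fun r => ∫ z, (Y (some (m, false)) z + Y (some (m, true)) z) ^ r ∂μ) (k + 1)
        - cumulantOf (fun r => ∫ z, (Y (some (m, false)) z) ^ r ∂μ) (k + 1) =
      (truncatedExp μ (psi1 s D κ a L w v m) (k + 1) - truncatedExp μ (psi1p s D κ a L w v m) (k + 1))
        + ∑ f ∈ univ.filter (fun f : Fin (k + 1) → Fin 3 => (∃ j, f j = 1) ∧ ∃ j, f j = 2),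
            ursellOf (fun P : Finset (Fin (k + 1)) => ∫ z, ∏ j ∈ P,
              (![fun z => psi1p s D κ a L w v m z, fun z => psi1pp s D κ a L w v m z, fun z => psi2 s D κ a L w m z] (f j)) z
                ∂μ) univ := by
    intro m
    have h3 := cumulantOf_three_eq_of_moments (μ := μ)
      (Y := ![fun z => psi1p s D κ a L w v m z, fun z => psi1pp s D κ a L w v m z, fun z => psi2 s D κ a L w m z])
      (fun c => by fin_cases c <;> simp [(hmo m).1.1, (hmo m).2.1.1, (hmo m).2.2.1.1]) k
      (fun c p _ => by fin_cases c <;> simp [(hmo m).1.2 p, (hmo m).2.1.2 p, (hmo m).2.2.1.2 p])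
    simp only [Matrix.cons_val_zero, Matrix.cons_val_one] at h3
    have ev2 : ∀ z, (![fun z => psi1p s D κ a L w v m z, fun z => psi1pp s D κ a L w v m z,
        fun z => psi2 s D κ a L w m z] : Fin 3 → (B1Eq324BenfattoLemma.Site d → ℝ) → ℝ) 2 z = psi2 s D κ a L w m z :=
      fun z => rfl
    simp only [ev2] at h3
    have eF : (fun r => ∫ z, (Y (some (m, false)) z + Y (some (m, true)) z) ^ r ∂μ) =
        fun r => ∫ z, (psi1p s D κ a L w v m z + psi1pp s D κ a L w v m z + psi2 s D κ a L w m z) ^ r ∂μ := by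
      funext r
      refine integral_congr_ae (ae_of_all _ fun z => ?_)
      simp only [hYf, hYt]
      ring_nf
    have eB : (fun r => ∫ z, (Y (some (m, false)) z) ^ r ∂μ) =
        fun r => ∫ z, (psi1p s D κ a L w v m z + psi2 s D κ a L w m z) ^ r ∂μ := by
      funext r
      simp only [hYf]
    have e1 : (fun r => ∫ z, (psi1p s D κ a L w v m z + psi1pp s D κ a L w v m z) ^ r ∂μ) =
        fun r => ∫ z, (psi1 s D κ a L w v m z) ^ r ∂μ := by
      funext r
      refine integral_congr_ae (ae_of_all _ fun z => ?_)
      dsimp only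
      rw [psi1pp, add_sub_cancel]
    rw [eF, eB, h3, e1, truncatedExp, truncatedExp]
    ring
  rw [hsumAll, hsumRest] at htel
  have hboxsum := Finset.sum_congr rfl fun (m : ↥B) (_ : m ∈ univ) => hbox m
  rw [Finset.sum_add_distrib] at hboxsum
  rw [hboxsum] at htel
  rw [truncatedExp, truncatedExp, ← Finset.sum_coe_sort B (fun m => truncatedExp μ (psi1 s D κ a L w v m) (k + 1) -
    truncatedExp μ (psi1p s D κ a L w v m) (k + 1)),
    ← Finset.sum_coe_sort B (fun m => ∑ f ∈ univ.filter (fun f : Fin (k + 1) → Fin 3 => (∃ j, f j = 1) ∧ ∃ j, f j = 2),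
      ursellOf (fun P : Finset (Fin (k + 1)) => ∫ z, ∏ j ∈ P,
        (![fun z => psi1p s D κ a L w v m z, fun z => psi1pp s D κ a L w v m z, fun z => psi2 s D κ a L w m z] (f j)) z
          ∂μ) univ)]
  simp only [truncatedExp] at htel ⊢
  linarith [htel]

end MeasureGeneric

/-! ## §2  The reference Gaussian of a GENERAL kernel: the moment row discharged, and frame COVARIANCE of the free cumulants -/

section KernelField

variable {s D : ℕ} {κ : ℝ} {a : Coef d} {J : Finset (B1Eq324BenfattoLemma.Site d)}
  {K : B1Eq324BenfattoLemma.Site d → B1Eq324BenfattoLemma.Site d → ℝ}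

/-- **THE MOMENT ROW OF §1 UNDER THE CENTRED GAUSSIAN FIELD OF ANY POSITIVE-SEMIDEFINITE KERNEL** («point 2)» of Appendix C for a general
covariance): if `K` is positive semidefinite and `K(y,y) ≤ c` for the sites `y ∈ J` carrying the datum (the port map's row R1), then every
tuple-class sum of (5.5)-terms over tuples in `J` is a.e.-strongly measurable under `μ_K = gaussianFieldOfKernel K` and has all absolute
moments — it is a `poly` in the coordinates (`…SlotMoments.tupleSum_eq_poly`), which are sub-Gaussian with parameter `c`
(`…SlotMoments.hasSubgaussianMGF_eval_gaussianFieldOfKernel`), so r14's `…GaussianMomentLeaf.integrable_abs_poly_pow` applies.  (Qualitative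
row only; the quantitative moment PACKAGE with its constant is the cluster side's `…SlotMoments` edition.)
[cite: BenfattoEtAl1978, Appendix C 2) p.164, (5.5) p.154] -/
theorem tupleSum_gaussianFieldOfKernel_moments (hK : IsPosSemidefKernel K) {c : ℝ≥0} (hc : ∀ y ∈ J, K y y ≤ c)
    (T : (p : ℕ) → Finset (Fin p → J)) :
    AEStronglyMeasurable (fun z : B1Eq324BenfattoLemma.Site d → ℝ =>
        ∑ p ∈ Finset.Icc 1 s, ∑ Δ ∈ T p, ∑ n ∈ admissible p D, term κ a z p Δ n) (gaussianFieldOfKernel K) ∧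
      ∀ q : ℕ, Integrable (fun z : B1Eq324BenfattoLemma.Site d → ℝ =>
        |∑ p ∈ Finset.Icc 1 s, ∑ Δ ∈ T p, ∑ n ∈ admissible p D, term κ a z p Δ n| ^ q) (gaussianFieldOfKernel K) := by
  classical
  haveI : IsProbabilityMeasure (gaussianFieldOfKernel K) := isProbabilityMeasure_gaussianFieldOfKernel hK
  have hfun : (fun z : B1Eq324BenfattoLemma.Site d → ℝ =>
      ∑ p ∈ Finset.Icc 1 s, ∑ Δ ∈ T p, ∑ n ∈ admissible p D, term κ a z p Δ n) = _ :=
    funext fun z => tupleSum_eq_poly (s := s) (D := D) (ϰ := κ) (a := a) T z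
  have hsg : ∀ mm ∈ (Finset.Icc 1 s).sigma (fun p => T p ×ˢ admissible p D),
      ∀ kr ∈ ((Finset.univ : Finset (Fin mm.1)).sigma fun i => Finset.range (mm.2.2 i)).map ⟨_, legPairs_injective mm.1⟩,
        HasSubgaussianMGF (fun z : B1Eq324BenfattoLemma.Site d → ℝ =>
          z ((fun k : ℕ => if h : k < mm.1 then (mm.2.1 ⟨k, h⟩ : B1Eq324BenfattoLemma.Site d)
            else (0 : B1Eq324BenfattoLemma.Site d)) kr.1)) c (gaussianFieldOfKernel K) := by
    intro mm _ kr hkr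
    obtain ⟨⟨i, r⟩, _, rfl⟩ := Finset.mem_map.1 hkr
    simp only [Function.Embedding.coeFn_mk, Fin.is_lt, dif_pos, Fin.eta]
    exact hasSubgaussianMGF_eval_gaussianFieldOfKernel hK _ (hc _ (mm.2.1 i).2)
  refine ⟨?_, fun q => ?_⟩
  · rw [hfun]; exact aestronglyMeasurable_poly hsg
  · simp_rw [tupleSum_eq_poly T]; exact integrable_abs_poly_pow hsg q

/-- **THE FREE TRUNCATED EXPECTATIONS OF A GENERAL KERNEL ARE FRAME COVARIANT** (p. 159 «a new pavement displaced by b²/2»; the kernel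
edition of `…Sect5PavementChain.truncatedExp_hamiltonian_frame`): for a positive-semidefinite `K`,
`Ê^T_{μ_K}(H^{A(·−τ)}_{J+τ}; k) = Ê^T_{μ_{K(·+τ,·+τ)}}(H^A_J; k)` — the Hamiltonian of the translated datum is the original one read on the
translated configuration (`…Sect5PavementChain` §1 / `…Sect5Iteration.hamiltonian_translate`), and the push-forward of `μ_K` under
`z ↦ z(· + τ)` is `μ_{K(·+τ,·+τ)}` (`…CondKernelGeneric.integral_gaussianFieldOfKernel_comp_add_right`).  For a translation-INVARIANT `K`
the right side is `Ê^T_{μ_K}(H^A_J; k)` again; in general the reference kernel is carried along the frames.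
[cite: BenfattoEtAl1978, (2.7) p.147, (4.7) p.152, §5 p.159] -/
theorem truncatedExp_hamiltonian_frame_kernel (hK : IsPosSemidefKernel K) (J : Finset (B1Eq324BenfattoLemma.Site d))
    (τ : B1Eq324BenfattoLemma.Site d) (k : ℕ) :
    truncatedExp (gaussianFieldOfKernel K) (hamiltonian s D κ (shiftCoef a (-τ)) (J.image fun x => x + τ)) k =
      truncatedExp (gaussianFieldOfKernel fun x y => K (x + τ) (y + τ)) (hamiltonian s D κ a J) k := by
  unfold truncatedExp
  congr 1
  funext r
  have hframe : ∀ z : B1Eq324BenfattoLemma.Site d → ℝ,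
      hamiltonian s D κ (shiftCoef a (-τ)) (J.image fun x => x + τ) z = hamiltonian s D κ a J fun x => z (x + τ) := by
    intro z
    rw [hamiltonian_translate]
    have hss : shiftCoef (shiftCoef a (-τ)) τ = a := by
      funext p Δ n
      simp only [shiftCoef, add_neg_cancel_right]
    rw [hss]
  simp only [hframe]
  exact integral_gaussianFieldOfKernel_comp_add_right hK τ (F := fun z => hamiltonian s D κ a J z ^ r)
    ((measurable_hamiltonian J).pow_const r)

/-- `Σ_{k≤t} Ê^T_{μ_K}(H^{A(·−τ)}_{J+τ}; k)/k! = Σ_{k≤t} Ê^T_{μ_{K(·+τ,·+τ)}}(H^A_J; k)/k!` (the bracket of (4.7) across a frame change, kernel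
edition of `…Sect5PavementChain.cumulantSum_hamiltonian_frame`). [cite: BenfattoEtAl1978, (4.7) p.152, §5 p.159] -/
theorem cumulantSum_hamiltonian_frame_kernel (hK : IsPosSemidefKernel K) (J : Finset (B1Eq324BenfattoLemma.Site d))
    (τ : B1Eq324BenfattoLemma.Site d) (t : ℕ) :
    cumulantSum (gaussianFieldOfKernel K) (hamiltonian s D κ (shiftCoef a (-τ)) (J.image fun x => x + τ)) t =
      cumulantSum (gaussianFieldOfKernel fun x y => K (x + τ) (y + τ)) (hamiltonian s D κ a J) t := by
  unfold cumulantSum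
  simp only [truncatedExp_hamiltonian_frame_kernel hK]

/-- The shifted kernel `K(·+τ, ·+τ)` is positive semidefinite with `K` — the reference field stays in any shift-closed class along the frames.
[cite: BenfattoEtAl1978, §5 p.159] -/
theorem isPosSemidefKernel_translate (hK : IsPosSemidefKernel K) (τ : B1Eq324BenfattoLemma.Site d) :
    IsPosSemidefKernel fun x y => K (x + τ) (y + τ) :=
  isPosSemidefKernel_reindex hK fun x => x + τ

end KernelField

/-! ## §3  §1 at the reference Gaussian `μ_K` of a general kernel -/

section KernelInstances

variable {s D : ℕ} {κ : ℝ} {a : Coef d} {J : Finset (B1Eq324BenfattoLemma.Site d)} {L w v : ℕ}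
  {K : B1Eq324BenfattoLemma.Site d → B1Eq324BenfattoLemma.Site d → ℝ}

/-- **`E(□)` IS A DIFFERENCE OF `μ_K`-CUMULANTS** — §1 at the centred Gaussian field of a positive-semidefinite kernel with `K(y,y) ≤ c` on `J`
(row discharged by `tupleSum_gaussianFieldOfKernel_moments`). [cite: BenfattoEtAl1978, (5.31)–(5.32) p.158] -/
theorem perBoxE_eq_sum_truncatedExp_sub_kernel (hK : IsPosSemidefKernel K) {c : ℝ≥0} (hc : ∀ y ∈ J, K y y ≤ c)
    (hJ : CoefSupportedIn a J) {m : B1Eq324BenfattoLemma.Site d}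
    (T : Fin 3 → (p : ℕ) → Finset (Fin p → J))
    (hT0 : ∀ p, T 0 p = tuplesIn J p (frame4 L w v m) ∪ crossT J p (frame4 L w v m) (frame3 L w v m))
    (hT1 : ∀ p, T 1 p = (tuplesIn J p (core L w m) \ tuplesIn J p (frame4 L w v m)) ∪
      (crossT J p (core L w m) (frame3 L w v m) \ crossT J p (frame4 L w v m) (frame3 L w v m)))
    (t : ℕ) :
    ∑ k ∈ Finset.range t,
        (∑ f ∈ univ.filter (fun f : Fin (k + 1) → Fin 3 => (∃ j, f j = 1) ∧ ∀ j, f j ≠ 2),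
          ursellOf (fun P : Finset (Fin (k + 1)) => ∫ z, ∏ j ∈ P,
            (∑ p ∈ Finset.Icc 1 s, ∑ Δ ∈ T (f j) p, ∑ n ∈ admissible p D, term κ a z p Δ n) ∂gaussianFieldOfKernel K) univ)
          / (k + 1)! =
      ∑ k ∈ Finset.range t,
        (truncatedExp (gaussianFieldOfKernel K) (psi1 s D κ a L w v m) (k + 1)
          - truncatedExp (gaussianFieldOfKernel K) (psi1p s D κ a L w v m) (k + 1)) / (k + 1)! := by
  haveI : IsProbabilityMeasure (gaussianFieldOfKernel K) := isProbabilityMeasure_gaussianFieldOfKernel hK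
  exact perBoxE_eq_sum_truncatedExp_sub_of_moments hJ
    (fun T' => tupleSum_gaussianFieldOfKernel_moments (s := s) (D := D) (κ := κ) (a := a) hK hc T') T hT0 hT1 t

/-- **THE TELESCOPE OF (5.35) UNDER `μ_K`** — §1 at the centred Gaussian field of a positive-semidefinite kernel with `K(y,y) ≤ c` on `J`:
`Σ_{m∈B} [T(Ψ₁(m)) − T(Ψ′₁(m))] = T(H_{Γ₁}+Σ_m(Ψ₁+Ψ₂)(m)) − T(H_{Γ₁}+Σ_m(Ψ′₁+Ψ₂)(m)) − CROSS − Σ_mW₂₉(m)`, `T = truncatedExp μ_K`.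
[cite: BenfattoEtAl1978, (5.31)–(5.35) pp.158–159] -/
theorem sum_truncatedExp_sub_eq_telescope_kernel {B : Finset (B1Eq324BenfattoLemma.Site d)} (hK : IsPosSemidefKernel K) {c : ℝ≥0}
    (hc : ∀ y ∈ J, K y y ≤ c) (hJ : CoefSupportedIn a J)
    (Y : Option (↥B × Bool) → (B1Eq324BenfattoLemma.Site d → ℝ) → ℝ)
    (hYn : Y none = fun z => hamiltonian s D κ a (corridors L w B) z)
    (hYf : ∀ m : ↥B, Y (some (m, false)) = fun z => psi1p s D κ a L w v m z + psi2 s D κ a L w m z)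
    (hYt : ∀ m : ↥B, Y (some (m, true)) = fun z => psi1pp s D κ a L w v m z) (k : ℕ) :
    ∑ m ∈ B, (truncatedExp (gaussianFieldOfKernel K) (psi1 s D κ a L w v m) (k + 1)
        - truncatedExp (gaussianFieldOfKernel K) (psi1p s D κ a L w v m) (k + 1)) =
      truncatedExp (gaussianFieldOfKernel K)
          (fun z => hamiltonian s D κ a (corridors L w B) z + ∑ m ∈ B, (psi1 s D κ a L w v m z + psi2 s D κ a L w m z)) (k + 1)
        - truncatedExp (gaussianFieldOfKernel K)
          (fun z => hamiltonian s D κ a (corridors L w B) z + ∑ m ∈ B, (psi1p s D κ a L w v m z + psi2 s D κ a L w m z)) (k + 1)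
        - ∑ f ∈ univ.filter (fun f : Fin (k + 1) → Option (↥B × Bool) =>
            (∃ j m, f j = some (m, true)) ∧ ¬∃ m, ∀ j, f j = some (m, false) ∨ f j = some (m, true)),
            ursellOf (fun P : Finset (Fin (k + 1)) => ∫ z, ∏ j ∈ P, Y (f j) z ∂gaussianFieldOfKernel K) univ
        - ∑ m ∈ B, ∑ f ∈ univ.filter (fun f : Fin (k + 1) → Fin 3 => (∃ j, f j = 1) ∧ ∃ j, f j = 2),
            ursellOf (fun P : Finset (Fin (k + 1)) => ∫ z, ∏ j ∈ P,
              (![fun z => psi1p s D κ a L w v m z, fun z => psi1pp s D κ a L w v m z, fun z => psi2 s D κ a L w m z] (f j)) z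
                ∂gaussianFieldOfKernel K) univ := by
  haveI : IsProbabilityMeasure (gaussianFieldOfKernel K) := isProbabilityMeasure_gaussianFieldOfKernel hK
  exact sum_truncatedExp_sub_eq_telescope_of_moments hJ
    (fun T' => tupleSum_gaussianFieldOfKernel_moments (s := s) (D := D) (κ := κ) (a := a) hK hc T') Y hYn hYf hYt k

end KernelInstances

end Literature.MathematicalPhysics.QuantumFieldTheory.Balaban1983to89.B1Eq324BenfattoKernelSect5FreeStep
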